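import Literature.MathematicalPhysics.QuantumFieldTheory.Balaban1983to89.T4AdjointCovariance
import Literature.MathematicalPhysics.QuantumFieldTheory.Balaban1983to89.UnitaryModel
import Literature.MathematicalPhysics.QuantumLattice.LatticeWilsonFlow
import Literature.Analysis.Matrix.DetExp

/-!
# Bałaban 1983–89, node O3.E-i′ (α), A-field half: THE UNITARY MATRIX MODEL of the abstract adjoint data of
# `T4AdjointCovariance` — `Ad(g)X = gXg*` on 𝔲(n) / 𝔰𝔲(n), the four standing hypotheses PROVED

(cell `pub-balaban`, self-proposed row T4-O3.E-i′-Oα-Ad-INST*; discharges GAPS G-pv04g7-3; kernel bookkeeping.)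

CITATION HEADER (lean-in-tree rule).  T. Bałaban, *Comm. Math. Phys.* **98** 17–51 (1985) [Balaban1985Averaging]
(= B7): p. 21 (the L²-norm sentence, i.e. the Hilbert–Schmidt norm (17), and the operator norm (19) «In estimates we
will use much more frequently another norm for matrices. It is the operator norm given by …»); p. 27, (56)–(57): «where
for arbitrary invertible matrix X the operator R(X) is given by the formula R(X)Y = XYX^{−1}.» «R(X) acts on the
algebra of all matrices and has the following properties: R(X)f(Y) = f(R(X)Y) for analytic functions f,
R(X)R(Y) = R(XY), R(X)^{−1} = R(X^{−1}), R(X)* = R(X*).»;  *Comm. Math. Phys.* **109** 249–301 (1987)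
[Balaban1987RG1] (= B12) p. 252: «that it is a Lie subgroup of a group of complex unitary matrices, for example
G⊂U(N).»;  *Comm. Math. Phys.* **99** 389–434 (1985) [Balaban1985BackgroundPropagators] (= B9): p. 390 «Let us
recall that R(U)X = UXU^{−1}.», p. 395 «Of course R(u(x))exp iηA(x,x′) = exp iηR(u(x))A(x,x′) and R(u)A is linear
in A»;  *Comm. Math. Phys.* **119** 243–285 (1988) [Balaban1988Convergent] (= B14) p. 250: the simultaneous gauge
transformation (1.17) «A → R(u)A, (R(u)A)(x,x′) = R(u(x))A(x,x′) = u(x)A(x,x′)u^{−1}(x)» and the Lie-algebra cut-offs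
of (1.18)/(1.19) «χ({sup_{b∈(□′^{~2})*}|A(b)| < g₀^{−1}δ₀})»,
«χ({sup_{b∈(□′^{~2})*}|exp ig₀A(b)U₁(b)U^{−1}_{1,□′}(b) − 1| < 2δ₀})».  EVERY quotation above is RE-USED VERBATIM from
loci already render-certified in the cell — B7 p. 21 and B12 p. 252: GAPS C-pv04g6-1 (module `T4FlatExteriorInvariance`,
cross-read C-b07g6-3); B7 p. 27, B9 pp. 390/395, B14 p. 250: GAPS C-pv04g7-1 (module `T4AdjointCovariance` (P1), (P5),
(P6), cross-read C-pv10-44) — and is CONTEXT only; NO new printed locus is read or quoted by this module.  Standard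
facts: Mathlib (`NormedSpace.exp_mem_unitary_of_mem_skewAdjoint`, `Matrix.exp_units_conj`,
`CStarRing.norm_mem_unitary_mul`), the tree's `Literature.Analysis.Matrix.det_exp_eq_exp_trace` (Liouville's formula,
[Hall2015] Thm. 2.12) and `Literature.MathematicalPhysics.QuantumLattice.frobeniusInnerProductSpace` (the real
Hilbert–Schmidt inner product `⟪A, B⟫ = Re Tr(A*B)` on `M_n(ℂ)`).

HONEST FRAMING.  The cell's T4 target is the existence and uniqueness of the continuum limit of Bałaban's unit-scale
averaged loop expectations on a finite torus; it is NOT the Yang–Mills mass gap and NOT the Clay problem.  This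
module proves NO estimate and NO statement of the papers.  `T4AdjointCovariance` types the adjoint representation
«R(u)» of (1.17) ABSTRACTLY (its reading (R3): a family `Ad : G → (V ≃ₗᵢ[ℝ] V)` of linear isometries of a real
inner-product space `V`, an exponential map `expV : V → G`, a norm-like function `nV : V → ℝ`) and carries the four
printed properties as HYPOTHESES of the lemmas that use them:
`hmul : Ad (g * h) v = Ad g (Ad h v)` and `hinv : Ad g⁻¹ (Ad g v) = v` («R(X)R(Y) = R(XY), R(X)^{−1} = R(X^{−1})»
(57)), `hexp : expV (Ad g v) = g * expV v * g⁻¹` («Of course R(u(x))exp iηA(x,x′) = exp iηR(u(x))A(x,x′)», B9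
p. 395), `hn : nV (Ad g v) = nV v` (unitary invariance of the norms (17)/(19)) — the cell's GAPS row G-pv04g7-3 (a cell
record, not print) reads: "[hypothesis] (kernel abstraction, dischargeable) … All are theorems for G ⊂ U(N) acting on
N × N matrices by X ↦ gXg⁻¹ with the trace inner product … but are NOT instantiated in this module."  THIS MODULE INSTANTIATES THEM: for `G = U(n)`
(`Matrix.unitaryGroup n ℂ`, the tree's `GaugeGroup` instance `UnitaryModel.instGaugeGroupUnitaryGroup`) acting by
`X ↦ gXg*` on its Lie algebra `𝔲(n)` = the skew-Hermitian matrices (`lieU n`, Mathlib's `skewAdjoint.submodule ℝ`)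
with the real Hilbert–Schmidt inner product, `expV = exp` (which lands in `U(n)` on `𝔲(n)`), `nV` = the
Hilbert–Schmidt norm or the operator norm; and for `G = SU(n)` (`Matrix.specialUnitaryGroup n ℂ`) on `𝔰𝔲(n)` = the
trace-free skew-Hermitian matrices (`lieSU n`; `exp` lands in `SU(n)` by `det exp X = exp Tr X`).  All four
hypotheses are then THEOREMS (`unitaryAd_mul`, `unitaryAd_inv_apply`, `expU_unitaryAd`, `norm_unitaryAd` /
`opNormU_unitaryAd`, and the `SU(n)` analogues), so the lemmas of `T4AdjointCovariance` that carry them hold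
hypothesis-free in the model (§4).  CONVENTION (recorded, not a quotation): print writes the bond variables as
`exp(iηA)`, `exp(ig₀A)` with `A` in the physicists' Hermitian convention; here `V` is the Lie algebra proper
(skew-Hermitian, `X = iA`) and the constants `η`, `g₀` are absorbed into `expV`, exactly as in `T4AdjointCovariance`
(`MixedSmallOn`'s docstring: "an abstract exponential map `expV : V → G` (absorbing g₀)"); `R(u(x))` acts on `X = iA` by the same
conjugation, so nothing printed is altered.

WHAT THE KERNEL PROVES (every declaration [folklore]; a [cite:] in a docstring is a LOCATOR of the printed identity
whose instance is proved, never a claim about the paper).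
* §1 `lieU n = 𝔲(n)` as a real submodule of `M_n(ℂ)`; conjugation `X ↦ UXU*` is real-linear and preserves `𝔲(n)`;
  for unitary `g` it preserves the Hilbert–Schmidt inner product (`inner_conj_unitary`), whence the linear ISOMETRY
  `unitaryAd g : 𝔲(n) ≃ₗᵢ[ℝ] 𝔲(n)` with `unitaryAd_mul` (hmul), `unitaryAd_inv_apply` (hinv), `unitaryAd_one`.
* §2 `expU : 𝔲(n) → U(n)`, `X ↦ exp X` (Mathlib: exp of a skew-adjoint element is unitary) with `expU_unitaryAd` (hexp):
  `exp(gXg*) = g·exp X·g⁻¹`.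
* §3 `norm_unitaryAd` (hn for the Hilbert–Schmidt norm (17)) and `opNorm_conj_unitary` / `opNormU_unitaryAd` (hn for
  the operator norm (19), Mathlib scope `Matrix.Norms.L2Operator`, the norm of `UnitaryModel`).
* §4 CONSEQUENCES: the hypothesis-carrying lemmas of `T4AdjointCovariance` specialised to the model with the hypotheses
  DISCHARGED — `opCovariant_covDeriv_unitary` (the covariant derivative (3.3) is a covariant family),
  `mixedSmallOn_joint_iff_unitary` (the mixed cut-off (1.19) is jointly invariant), `invariant_charFn_mixedSmallOn_unitary`
  (still relative to a rotation-fixed reference field `hW`, which is O-α4 (ii), untouched),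
  `invariant_charFn_supSmallOn_unitary` / `…_opNorm` (the sup cut-off (1.18) for either norm); the Borel structure on
  `𝔲(n)` making the measure-level hand-off `conjInvariant_marginal` available (`conjInvariant_marginal_unitary`).
* §5 the same for `SU(n)` on `𝔰𝔲(n)` (`lieSU`, `specialUnitaryAd`, `expSU`, …).
* §6 NON-VACUITY: `𝔲(n) ≠ 0` for `n` non-empty (`I • 1 ∈ 𝔲(n)`), `𝔰𝔲(n) ≠ 0` for `|n| ≥ 2`.

NOT CLAIMED / NOT DONE.  (i) A general closed Lie subgroup `G ⊂ U(N)` (B7 p. 20) with its own Lie algebra is not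
treated — only `U(n)` and `SU(n)`; (ii) the reference-field fixedness `hW` of `mixedSmallOn_joint_iff_of_fixed` is NOT
discharged (it is O-α4 (ii): uniqueness of minimisers / block fields, GAPS G-pv04g6-3); (iii) no operator of the papers
is constructed and nothing of GAPS G-pv04g7-1 / -2 is touched; (iv) no estimate.  Value = non-vacuity certificate of an
interface + kernel bookkeeping, NOT summit progress.
-/

noncomputable section

open MeasureTheory
open Matrix

namespace Literature.MathematicalPhysics.QuantumFieldTheory.Balaban1983to89.T4AdjointCovarianceUnitary

open T4AdjointCovariance T4NestedCovariance T4NestedCovarianceFibre GaugeField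
open T4FlatExteriorInvariance hiding conjEquiv coe_conjEquiv

variable {n : Type*} [Fintype n] [DecidableEq n]

/-! ## §1 The Lie algebra 𝔲(n) and the adjoint action of U(n) -/

section LieAlgebra

/-- THE LIE ALGEBRA 𝔲(n) OF U(n): the skew-Hermitian matrices `X* = −X`, as a real submodule of `M_n(ℂ)` (Mathlib's
`skewAdjoint.submodule ℝ`). [folklore] -/
def lieU (n : Type*) : Submodule ℝ (Matrix n n ℂ) := skewAdjoint.submodule ℝ (Matrix n n ℂ)

omit [Fintype n] [DecidableEq n] in
/-- Membership in 𝔲(n). [folklore] -/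
theorem mem_lieU_iff {X : Matrix n n ℂ} : X ∈ lieU n ↔ star X = -X := skewAdjoint.mem_iff

omit [Fintype n] [DecidableEq n] in
/-- Membership in 𝔲(n) is membership in Mathlib's `skewAdjoint`. [folklore] -/
theorem mem_skewAdjoint_of_mem_lieU {X : Matrix n n ℂ} (hX : X ∈ lieU n) : X ∈ skewAdjoint (Matrix n n ℂ) :=
  skewAdjoint.mem_iff.mpr (mem_lieU_iff.mp hX)

/-- THE CONJUGATION «R(X)Y = XYX^{−1}» for unitary X, i.e. `Y ↦ UYU*`, as a real-linear map of `M_n(ℂ)`.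
[cite: Balaban1985Averaging, (56) p.27] -/
def conjL (U : Matrix n n ℂ) : Matrix n n ℂ →ₗ[ℝ] Matrix n n ℂ where
  toFun X := U * X * star U
  map_add' X Y := by rw [Matrix.mul_add, Matrix.add_mul]
  map_smul' c X := by
    simp only [RingHom.id_apply, Matrix.mul_smul, Matrix.smul_mul]

omit [DecidableEq n] in
/-- `conjL U X = U X U*`. [folklore] -/
@[simp] theorem conjL_apply (U X : Matrix n n ℂ) : conjL U X = U * X * star U := rfl

omit [DecidableEq n] in
/-- Conjugation by ANY matrix preserves skew-Hermiticity: `(UXU*)* = U X* U* = −UXU*`. [folklore] -/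
theorem conj_mem_lieU {X : Matrix n n ℂ} (hX : X ∈ lieU n) (U : Matrix n n ℂ) : U * X * star U ∈ lieU n := by
  rw [mem_lieU_iff] at hX ⊢
  rw [star_mul, star_mul, star_star, hX, Matrix.neg_mul, Matrix.mul_neg, Matrix.mul_assoc]

/-- The adjoint action of `g ∈ U(n)` on 𝔲(n) as a real-linear map. [folklore] -/
def adLin (g : Matrix.unitaryGroup n ℂ) : lieU n →ₗ[ℝ] lieU n :=
  (conjL (g : Matrix n n ℂ)).restrict fun _ hX => conj_mem_lieU hX _

/-- `adLin g X = g X g*` on underlying matrices. [folklore] -/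
@[simp] theorem coe_adLin (g : Matrix.unitaryGroup n ℂ) (X : lieU n) :
    ((adLin g X : lieU n) : Matrix n n ℂ) = (g : Matrix n n ℂ) * X * star (g : Matrix n n ℂ) := rfl

/-- `g* g = 1` for `g ∈ U(n)`. [folklore] -/
theorem star_coe_mul_coe (g : Matrix.unitaryGroup n ℂ) : star (g : Matrix n n ℂ) * g = 1 :=
  Unitary.coe_star_mul_self g

/-- `g g* = 1` for `g ∈ U(n)`. [folklore] -/
theorem coe_mul_star_coe (g : Matrix.unitaryGroup n ℂ) : (g : Matrix n n ℂ) * star (g : Matrix n n ℂ) = 1 :=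
  Unitary.coe_mul_star_self g

omit [DecidableEq n] in
/-- «R(X)R(Y) = R(XY)» on matrices: `(gh)X(gh)* = g(hXh*)g*`. [cite: Balaban1985Averaging, (57) p.27] -/
theorem conj_mul_conj (g h X : Matrix n n ℂ) :
    g * h * X * star (g * h) = g * (h * X * star h) * star g := by
  rw [star_mul]; simp only [Matrix.mul_assoc]

/-- «R(X)^{−1} = R(X^{−1})» on matrices: if `VU = 1` then `V(UXU*)V* = X`. [cite: Balaban1985Averaging, (57) p.27] -/
theorem conj_conj_of_mul_eq_one {U V : Matrix n n ℂ} (h : V * U = 1) (X : Matrix n n ℂ) :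
    V * (U * X * star U) * star V = X := by
  calc V * (U * X * star U) * star V = V * U * X * star (V * U) := by
        rw [star_mul]; simp only [Matrix.mul_assoc]
    _ = X := by rw [h, star_one, Matrix.one_mul, Matrix.mul_one]

/-- The adjoint action of `g ∈ U(n)` on 𝔲(n) as a real-linear AUTOMORPHISM (inverse: the action of `g⁻¹ = g*`).
[folklore] -/
def adEquiv (g : Matrix.unitaryGroup n ℂ) : lieU n ≃ₗ[ℝ] lieU n :=
  { adLin g with
    invFun := adLin g⁻¹
    left_inv := fun X => Subtype.ext <| conj_conj_of_mul_eq_one (star_coe_mul_coe g) (X : Matrix n n ℂ)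
    right_inv := fun X => Subtype.ext <| conj_conj_of_mul_eq_one (coe_mul_star_coe g) (X : Matrix n n ℂ) }

/-- `adEquiv g X = g X g*` on underlying matrices. [folklore] -/
@[simp] theorem coe_adEquiv (g : Matrix.unitaryGroup n ℂ) (X : lieU n) :
    ((adEquiv g X : lieU n) : Matrix n n ℂ) = (g : Matrix n n ℂ) * X * star (g : Matrix n n ℂ) := rfl

end LieAlgebra


/-! ## §3a The operator norm is unitarily invariant (B7 (19)) -/

section OpNorm

open scoped Matrix.Norms.L2Operator

/-- THE OPERATOR NORM (19) on `M_n(ℂ) = L(ℂⁿ)` restricted to 𝔲(n) (Mathlib scope `Matrix.Norms.L2Operator`, the norm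
of `UnitaryModel.opDist1`). [cite: Balaban1985Averaging, (19) p.21] -/
def opNormU (X : lieU n) : ℝ := ‖(X : Matrix n n ℂ)‖

/-- The operator norm is invariant under unitary conjugation: `‖gXg*‖ = ‖X‖` (`M_n(ℂ)` is a C⋆-algebra).
[folklore] -/
theorem opNorm_conj_unitary (g : Matrix.unitaryGroup n ℂ) (X : Matrix n n ℂ) :
    ‖(g : Matrix n n ℂ) * X * star (g : Matrix n n ℂ)‖ = ‖X‖ := by
  rw [CStarRing.norm_mul_mem_unitary _ (Unitary.star_mem g.2), CStarRing.norm_mem_unitary_mul _ g.2]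

end OpNorm

/-! ## §1 (continued), §2, §3b, §4: the Hilbert–Schmidt model -/

section Frobenius

open scoped Matrix.Norms.Frobenius

attribute [local instance] Literature.MathematicalPhysics.QuantumLattice.frobeniusInnerProductSpace

open Literature.MathematicalPhysics.QuantumLattice (frobenius_inner_def)

/-! ### Pinned instances on 𝔲(n) (Hilbert–Schmidt norm), so that the abstract lemmas of `T4AdjointCovariance`
(binders `[NormedAddCommGroup V] [InnerProductSpace ℝ V] [MeasurableSpace V] [BorelSpace V]`) apply syntactically -/

/-- 𝔲(n) with THE HILBERT–SCHMIDT (L²-) NORM of (17), `‖X‖² = Σ|X_ij|² = Tr X*X` (induced from the Frobenius norm of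
`M_n(ℂ)`; the formula is the standard one, recorded as in `UnitaryModel`'s header, not quoted from print).
[cite: Balaban1985Averaging, (17) p.21] -/
instance instNormedAddCommGroupLieU : NormedAddCommGroup (lieU n) := Submodule.normedAddCommGroup _

/-- (the seminormed structure is the one underlying `instNormedAddCommGroupLieU`). [folklore] -/
instance instSeminormedAddCommGroupLieU : SeminormedAddCommGroup (lieU n) :=
  NormedAddCommGroup.toSeminormedAddCommGroup

/-- 𝔲(n) as a real inner-product space, `⟪X, Y⟫ = Re Tr(X*Y)`. [cite: Balaban1985Averaging, (17) p.21] -/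
instance instInnerProductSpaceLieU : InnerProductSpace ℝ (lieU n) := Submodule.innerProductSpace _

/-- The Borel σ-algebra on 𝔲(n), generated by ITS NORM TOPOLOGY (pinned path, so that Mathlib's
`measureSpaceOfInnerProductSpace` — the Lebesgue measure `volume` of the inner-product space 𝔲(n), the dA of the
fluctuation integrals — is found by instance search). [folklore] -/
instance instMeasurableSpaceLieU : MeasurableSpace (lieU n) :=
  @borel (lieU n) (@UniformSpace.toTopologicalSpace _ (@PseudoMetricSpace.toUniformSpace _
    (@SeminormedAddCommGroup.toPseudoMetricSpace _ (instSeminormedAddCommGroupLieU (n := n)))))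

/-- `instMeasurableSpaceLieU` is the Borel σ-algebra of the norm topology of 𝔲(n). [folklore] -/
instance instBorelSpaceLieU : @BorelSpace (lieU n) (@UniformSpace.toTopologicalSpace _ (@PseudoMetricSpace.toUniformSpace _
    (@SeminormedAddCommGroup.toPseudoMetricSpace _ (instSeminormedAddCommGroupLieU (n := n))))) instMeasurableSpaceLieU :=
  ⟨rfl⟩

/-- … which is also the Borel σ-algebra of the subspace topology inherited from `M_n(ℂ) = n → n → ℂ` (the two
topologies coincide definitionally). [folklore] -/
instance instBorelSpaceLieU' : @BorelSpace (lieU n) instTopologicalSpaceSubtype instMeasurableSpaceLieU := ⟨rfl⟩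

/-- `(X : 𝔲(n))` has the Frobenius norm of its matrix. [folklore] -/
theorem norm_coe_lieU (X : lieU n) : ‖X‖ = ‖(X : Matrix n n ℂ)‖ := rfl

/-- Unitary conjugation preserves THE HILBERT–SCHMIDT INNER PRODUCT `Re Tr(X*Y)` of `M_n(ℂ)` (the inner product of the L²-norm (17)):
`Tr((gXg*)*(gYg*)) = Tr(g X*Y g*) = Tr(X*Y)`. [cite: Balaban1985Averaging, (17) p.21] -/
theorem inner_conj_unitary (g : Matrix.unitaryGroup n ℂ) (X Y : Matrix n n ℂ) :
    inner ℝ ((g : Matrix n n ℂ) * X * star (g : Matrix n n ℂ)) ((g : Matrix n n ℂ) * Y * star (g : Matrix n n ℂ))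
      = inner ℝ X Y := by
  rw [frobenius_inner_def, frobenius_inner_def]
  congr 1
  have hg : (g : Matrix n n ℂ)ᴴ * (g : Matrix n n ℂ) = 1 := by
    rw [← star_eq_conjTranspose]; exact star_coe_mul_coe g
  calc (((g : Matrix n n ℂ) * X * star (g : Matrix n n ℂ))ᴴ * ((g : Matrix n n ℂ) * Y * star (g : Matrix n n ℂ))).trace
      = ((g : Matrix n n ℂ) * (Xᴴ * (((g : Matrix n n ℂ)ᴴ * (g : Matrix n n ℂ)) * Y)) * (g : Matrix n n ℂ)ᴴ).trace := by
        simp only [star_eq_conjTranspose, conjTranspose_mul, conjTranspose_conjTranspose, Matrix.mul_assoc]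
    _ = ((g : Matrix n n ℂ) * (Xᴴ * Y) * (g : Matrix n n ℂ)ᴴ).trace := by rw [hg, Matrix.one_mul]
    _ = ((g : Matrix n n ℂ)ᴴ * (g : Matrix n n ℂ) * (Xᴴ * Y)).trace := Matrix.trace_mul_cycle _ _ _
    _ = (Xᴴ * Y).trace := by rw [hg, Matrix.one_mul]

/-- THE ADJOINT REPRESENTATION «(R(u)A)(x,x′) = R(u(x))A(x,x′) = u(x)A(x,x′)u^{−1}(x)» of `U(n)` on 𝔲(n) as a
family of LINEAR ISOMETRIES for the Hilbert–Schmidt inner product — the intended instance of the abstract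
`Ad : G → (V ≃ₗᵢ[ℝ] V)` of `T4AdjointCovariance` (reading (R3) there). [cite: Balaban1988Convergent, (1.17) p.250] -/
def unitaryAd (g : Matrix.unitaryGroup n ℂ) : lieU n ≃ₗᵢ[ℝ] lieU n :=
  (adEquiv g).isometryOfInner fun X Y => by
    rw [Submodule.coe_inner, Submodule.coe_inner, coe_adEquiv, coe_adEquiv]
    exact inner_conj_unitary g X Y

/-- `unitaryAd g X = g X g*` on underlying matrices. [folklore] -/
@[simp] theorem coe_unitaryAd (g : Matrix.unitaryGroup n ℂ) (X : lieU n) :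
    ((unitaryAd g X : lieU n) : Matrix n n ℂ) = (g : Matrix n n ℂ) * X * star (g : Matrix n n ℂ) := rfl

/-- HYPOTHESIS `hmul` OF `T4AdjointCovariance` DISCHARGED: «R(X)R(Y) = R(XY)». [cite: Balaban1985Averaging, (57) p.27] -/
theorem unitaryAd_mul (g h : Matrix.unitaryGroup n ℂ) (X : lieU n) :
    unitaryAd (g * h) X = unitaryAd g (unitaryAd h X) := by
  apply Subtype.ext
  simp only [coe_unitaryAd, Matrix.UnitaryGroup.mul_val]
  exact conj_mul_conj _ _ _

/-- HYPOTHESIS `hinv` OF `T4AdjointCovariance` DISCHARGED: «R(X)^{−1} = R(X^{−1})». [cite: Balaban1985Averaging, (57) p.27] -/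
theorem unitaryAd_inv_apply (g : Matrix.unitaryGroup n ℂ) (X : lieU n) : unitaryAd g⁻¹ (unitaryAd g X) = X :=
  Subtype.ext <| conj_conj_of_mul_eq_one (star_coe_mul_coe g) (X : Matrix n n ℂ)

/-- `Ad(1) = id`. [folklore] -/
theorem unitaryAd_one (X : lieU n) : unitaryAd (1 : Matrix.unitaryGroup n ℂ) X = X := by
  apply Subtype.ext
  simp only [coe_unitaryAd, Matrix.UnitaryGroup.one_val, star_one, Matrix.one_mul, Matrix.mul_one]

/-! ### §2 The exponential map -/

set_option backward.isDefEq.respectTransparency false in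
/-- `exp X ∈ U(n)` for `X ∈ 𝔲(n)` (Mathlib `NormedSpace.exp_mem_unitary_of_mem_skewAdjoint`). [folklore] -/
theorem exp_mem_unitaryGroup_of_mem_lieU {X : Matrix n n ℂ} (hX : X ∈ lieU n) :
    NormedSpace.exp X ∈ Matrix.unitaryGroup n ℂ :=
  open scoped Matrix.Norms.Operator in NormedSpace.exp_mem_unitary_of_mem_skewAdjoint (mem_skewAdjoint_of_mem_lieU hX)

/-- THE EXPONENTIAL MAP `𝔲(n) → U(n)`, `X ↦ exp X` — the instance of the abstract `expV : V → G` of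
`T4AdjointCovariance.MixedSmallOn` (print: the bond variables «exp iηA(x,x′)», «exp ig₀A(b)», constants absorbed, `X = iA`).
[cite: Balaban1988Convergent, (1.19) p.250] -/
def expU (X : lieU n) : Matrix.unitaryGroup n ℂ := ⟨NormedSpace.exp (X : Matrix n n ℂ), exp_mem_unitaryGroup_of_mem_lieU X.2⟩

/-- `expU X = exp X` on underlying matrices. [folklore] -/
@[simp] theorem coe_expU (X : lieU n) : ((expU X : Matrix.unitaryGroup n ℂ) : Matrix n n ℂ) = NormedSpace.exp (X : Matrix n n ℂ) :=
  rfl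

/-- `exp(gXg⁻¹) = g exp(X) g⁻¹` for unitary `g` («R(X)f(Y) = f(R(X)Y) for analytic functions f», here f = exp; Mathlib
`Matrix.exp_units_conj`). [cite: Balaban1985Averaging, (57) p.27] -/
theorem exp_conj_unitary (g : Matrix.unitaryGroup n ℂ) (X : Matrix n n ℂ) :
    NormedSpace.exp ((g : Matrix n n ℂ) * X * star (g : Matrix n n ℂ))
      = (g : Matrix n n ℂ) * NormedSpace.exp X * star (g : Matrix n n ℂ) := by
  have h := Matrix.exp_units_conj (Unitary.toUnits g) X
  simpa only [Unitary.val_toUnits_apply, Unitary.val_inv_toUnits_apply, Matrix.UnitaryGroup.inv_val] using h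

/-- HYPOTHESIS `hexp` OF `T4AdjointCovariance` DISCHARGED: «Of course R(u(x))exp iηA(x,x′) = exp iηR(u(x))A(x,x′)» —
`expU (Ad(g)X) = g · expU X · g⁻¹` in `U(n)`. [cite: Balaban1985BackgroundPropagators, (3.29) p.395] -/
theorem expU_unitaryAd (g : Matrix.unitaryGroup n ℂ) (X : lieU n) : expU (unitaryAd g X) = g * expU X * g⁻¹ := by
  apply Subtype.ext
  simp only [coe_expU, coe_unitaryAd, Matrix.UnitaryGroup.mul_val, Matrix.UnitaryGroup.inv_val]
  exact exp_conj_unitary g X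

/-! ### §3b Norm invariance -/

/-- HYPOTHESIS `hn` OF `T4AdjointCovariance` DISCHARGED for the Hilbert–Schmidt norm (17): `|gXg*| = |X|` (an isometry
preserves the norm). [cite: Balaban1985Averaging, (17) p.21] -/
theorem norm_unitaryAd (g : Matrix.unitaryGroup n ℂ) (X : lieU n) : ‖unitaryAd g X‖ = ‖X‖ :=
  (unitaryAd g).norm_map X

/-- HYPOTHESIS `hn` DISCHARGED for the operator norm (19): `opNormU (Ad(g)X) = opNormU X`. [cite: Balaban1985Averaging, (19) p.21] -/
theorem opNormU_unitaryAd (g : Matrix.unitaryGroup n ℂ) (X : lieU n) : opNormU (unitaryAd g X) = opNormU X := by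
  unfold opNormU
  rw [coe_unitaryAd]
  exact opNorm_conj_unitary g X

/-! ### §4 Consequences: the hypothesis-carrying lemmas of `T4AdjointCovariance` in the model -/

section Consequences

variable [Nonempty n] {P : Params} {j : ℕ}

/-- THE COVARIANT DERIVATIVE (3.3) along the background, in the unitary model, IS A COVARIANT FAMILY for the joint
rotation — `T4AdjointCovariance.opCovariant_covDeriv` with `hmul`, `hinv` discharged. [cite: Balaban1985BackgroundPropagators, (3.3) p.391] -/
theorem opCovariant_covDeriv_unitary :
    OpCovariant (jrot (P := P) (j := j) (G := Matrix.unitaryGroup n ℂ)) (adAct unitaryAd (ι := Site P j))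
      (adAct unitaryAd (ι := PBond P j)) (covDeriv unitaryAd) := by
  exact opCovariant_covDeriv unitaryAd_mul unitaryAd_inv_apply

/-- `covDeriv` commutes with the joint rotation, pointwise form. [folklore] -/
theorem covDeriv_conjFun_unitary (g : Matrix.unitaryGroup n ℂ) (U : GaugeField P j (Matrix.unitaryGroup n ℂ))
    (lam : SiteField P j (lieU n)) :
    covDeriv unitaryAd (conjFun g U) (adAct unitaryAd g lam) = adAct unitaryAd g (covDeriv unitaryAd U lam) := by
  exact covDeriv_conjFun unitaryAd_mul unitaryAd_inv_apply g U lam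

/-- THE MIXED CUT-OFF (1.19) «|exp ig₀A(b)U₁(b)U^{−1}_{1,□′}(b) − 1| < 2δ₀» IS JOINTLY INVARIANT in the unitary model —
`T4AdjointCovariance.mixedSmallOn_joint_iff` with `hexp` discharged. [cite: Balaban1988Convergent, (1.19) p.250] -/
theorem mixedSmallOn_joint_iff_unitary (S : Set (PBond P j)) (δ : ℝ) (g : Matrix.unitaryGroup n ℂ)
    (W U : GaugeField P j (Matrix.unitaryGroup n ℂ)) (A : VecField P j (lieU n)) :
    MixedSmallOn S δ expU (conjFun g W) (conjFun g U) (adAct unitaryAd g A) ↔ MixedSmallOn S δ expU W U A := by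
  exact mixedSmallOn_joint_iff expU_unitaryAd S δ g W U A

/-- … with a rotation-FIXED reference field (hypothesis `hW`, NOT discharged here: O-α4 (ii)). [folklore] -/
theorem mixedSmallOn_joint_iff_of_fixed_unitary (S : Set (PBond P j)) (δ : ℝ) {g : Matrix.unitaryGroup n ℂ}
    {W : GaugeField P j (Matrix.unitaryGroup n ℂ)} (hW : conjFun g W = W) (U : GaugeField P j (Matrix.unitaryGroup n ℂ))
    (A : VecField P j (lieU n)) :
    MixedSmallOn S δ expU W (conjFun g U) (adAct unitaryAd g A) ↔ MixedSmallOn S δ expU W U A := by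
  exact mixedSmallOn_joint_iff_of_fixed expU_unitaryAd S δ hW U A

/-- The (1.19)-type characteristic function is a jointly invariant weight in the unitary model (given a fixed
reference field). [folklore] -/
theorem invariant_charFn_mixedSmallOn_unitary (S : Set (PBond P j)) (δ : ℝ)
    {W : GaugeField P j (Matrix.unitaryGroup n ℂ)} (hW : ∀ g : Matrix.unitaryGroup n ℂ, conjFun g W = W) :
    Invariant (prodAct (jrot (P := P) (j := j) (G := Matrix.unitaryGroup n ℂ)) (adAct unitaryAd (ι := PBond P j)))
      (charFn fun p : GaugeField P j (Matrix.unitaryGroup n ℂ) × VecField P j (lieU n) =>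
        MixedSmallOn S δ expU W p.1 p.2) := by
  exact invariant_charFn_mixedSmallOn expU_unitaryAd S δ hW

/-- THE SUP CUT-OFF of (1.18), «χ({sup_{b∈(□′^{~2})*}|A(b)| < g₀^{−1}δ₀})», with the Hilbert–Schmidt norm is a jointly invariant weight in the
unitary model — `hn` discharged. [cite: Balaban1988Convergent, (1.18) p.250] -/
theorem invariant_charFn_supSmallOn_unitary (S : Set (PBond P j)) (δ : ℝ) :
    Invariant (prodAct (jrot (P := P) (j := j) (G := Matrix.unitaryGroup n ℂ)) (adAct unitaryAd (ι := PBond P j)))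
      (charFn fun p : GaugeField P j (Matrix.unitaryGroup n ℂ) × VecField P j (lieU n) =>
        SupSmallOn S (fun X : lieU n => ‖X‖) δ p.2) := by
  exact invariant_charFn_supSmallOn norm_unitaryAd S δ

/-- … and with the operator norm (19). [folklore] -/
theorem invariant_charFn_supSmallOn_opNorm_unitary (S : Set (PBond P j)) (δ : ℝ) :
    Invariant (prodAct (jrot (P := P) (j := j) (G := Matrix.unitaryGroup n ℂ)) (adAct unitaryAd (ι := PBond P j)))
      (charFn fun p : GaugeField P j (Matrix.unitaryGroup n ℂ) × VecField P j (lieU n) =>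
        SupSmallOn S opNormU δ p.2) := by
  exact invariant_charFn_supSmallOn opNormU_unitaryAd S δ

omit [Nonempty n] in
/-- The sup cut-off alone is invariant under the constant adjoint action (either norm). [folklore] -/
theorem supSmallOn_adAct_iff_unitary {ι : Type*} (S : Set ι) (δ : ℝ) (g : Matrix.unitaryGroup n ℂ) (A : ι → lieU n) :
    (SupSmallOn S (fun X : lieU n => ‖X‖) δ (adAct unitaryAd g A) ↔ SupSmallOn S (fun X : lieU n => ‖X‖) δ A) ∧
      (SupSmallOn S opNormU δ (adAct unitaryAd g A) ↔ SupSmallOn S opNormU δ A) := by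
  exact ⟨supSmallOn_adAct_iff norm_unitaryAd δ g A, supSmallOn_adAct_iff opNormU_unitaryAd δ g A⟩

end Consequences

/-! ### §4b Measure level: the Borel structure on 𝔲(n) and the hand-off `conjInvariant_marginal` -/

section MeasureLevel

variable [Nonempty n] {P : Params} {j : ℕ} {ι : Type*} [Fintype ι]

omit [Nonempty n] in
/-- The product Lebesgue measure on 𝔲(n)-valued fields is invariant under the constant adjoint action of `U(n)`
(`T4AdjointCovariance.pi_volume_map_adAct` in the model). [folklore] -/
theorem pi_volume_map_adAct_unitary (g : Matrix.unitaryGroup n ℂ) :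
    (Measure.pi fun _ : ι => (volume : Measure (lieU n))).map (adAct unitaryAd g)
      = Measure.pi fun _ : ι => (volume : Measure (lieU n)) := by
  exact pi_volume_map_adAct unitaryAd g

/-- HAND-OFF in the model: a jointly invariant weight integrates over the 𝔲(n)-valued fluctuation field to a
`ConjInvariant` function of the `U(n)` background (`T4AdjointCovariance.conjInvariant_marginal`). [folklore] -/
theorem conjInvariant_marginal_unitary {W : Type*} [NormedAddCommGroup W] [NormedSpace ℝ W]
    {w : GaugeField P j (Matrix.unitaryGroup n ℂ) × (ι → lieU n) → W}
    (hw : Invariant (prodAct (jrot (P := P) (j := j) (G := Matrix.unitaryGroup n ℂ)) (adAct unitaryAd (ι := ι))) w) :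
    ConjInvariant fun U : GaugeField P j (Matrix.unitaryGroup n ℂ) =>
      ∫ A, w (U, A) ∂(Measure.pi fun _ : ι => (volume : Measure (lieU n))) := by
  exact conjInvariant_marginal unitaryAd hw

end MeasureLevel

/-! ## §5 The special unitary group SU(n) on 𝔰𝔲(n) -/

section SpecialUnitary

/-- THE LIE ALGEBRA 𝔰𝔲(n) OF SU(n): trace-free skew-Hermitian matrices, as a real submodule. [folklore] -/
def lieSU (n : Type*) [Fintype n] : Submodule ℝ (Matrix n n ℂ) :=
  lieU n ⊓ LinearMap.ker ((Matrix.traceLinearMap n ℂ ℂ).restrictScalars ℝ)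

omit [DecidableEq n] in
/-- Membership in 𝔰𝔲(n). [folklore] -/
theorem mem_lieSU_iff {X : Matrix n n ℂ} : X ∈ lieSU n ↔ star X = -X ∧ X.trace = 0 := by
  simp only [lieSU, Submodule.mem_inf, mem_lieU_iff, LinearMap.mem_ker, LinearMap.coe_restrictScalars,
    Matrix.traceLinearMap_apply]

/-- 𝔰𝔲(n) with the Hilbert–Schmidt norm (17) (pinned instance, as for 𝔲(n)). [cite: Balaban1985Averaging, (17) p.21] -/
instance instNormedAddCommGroupLieSU : NormedAddCommGroup (lieSU n) := Submodule.normedAddCommGroup _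

/-- (the seminormed structure underlying `instNormedAddCommGroupLieSU`). [folklore] -/
instance instSeminormedAddCommGroupLieSU : SeminormedAddCommGroup (lieSU n) :=
  NormedAddCommGroup.toSeminormedAddCommGroup

/-- 𝔰𝔲(n) as a real inner-product space, `⟪X, Y⟫ = Re Tr(X*Y)`. [cite: Balaban1985Averaging, (17) p.21] -/
instance instInnerProductSpaceLieSU : InnerProductSpace ℝ (lieSU n) := Submodule.innerProductSpace _

/-- The Borel σ-algebra on 𝔰𝔲(n), generated by its norm topology (pinned path). [folklore] -/
instance instMeasurableSpaceLieSU : MeasurableSpace (lieSU n) :=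
  @borel (lieSU n) (@UniformSpace.toTopologicalSpace _ (@PseudoMetricSpace.toUniformSpace _
    (@SeminormedAddCommGroup.toPseudoMetricSpace _ (instSeminormedAddCommGroupLieSU (n := n)))))

/-- `instMeasurableSpaceLieSU` is the Borel σ-algebra of the norm topology of 𝔰𝔲(n). [folklore] -/
instance instBorelSpaceLieSU : @BorelSpace (lieSU n) (@UniformSpace.toTopologicalSpace _ (@PseudoMetricSpace.toUniformSpace _
    (@SeminormedAddCommGroup.toPseudoMetricSpace _ (instSeminormedAddCommGroupLieSU (n := n))))) instMeasurableSpaceLieSU :=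
  ⟨rfl⟩

/-- Conjugation by a unitary preserves 𝔰𝔲(n) (trace is conjugation invariant). [folklore] -/
theorem conj_mem_lieSU {X : Matrix n n ℂ} (hX : X ∈ lieSU n) (g : Matrix.unitaryGroup n ℂ) :
    (g : Matrix n n ℂ) * X * star (g : Matrix n n ℂ) ∈ lieSU n := by
  rw [mem_lieSU_iff] at hX ⊢
  refine ⟨mem_lieU_iff.mp (conj_mem_lieU (mem_lieU_iff.mpr hX.1) _), ?_⟩
  rw [Matrix.trace_mul_cycle, star_coe_mul_coe, Matrix.one_mul, hX.2]

/-- `SU(n) ⊂ U(n)`. [folklore] -/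
def toUnitary (g : Matrix.specialUnitaryGroup n ℂ) : Matrix.unitaryGroup n ℂ := ⟨g, g.2.1⟩

/-- Underlying matrix of `toUnitary g`. [folklore] -/
@[simp] theorem coe_toUnitary (g : Matrix.specialUnitaryGroup n ℂ) : ((toUnitary g : Matrix.unitaryGroup n ℂ) : Matrix n n ℂ) = g :=
  rfl

/-- `toUnitary` is multiplicative. [folklore] -/
theorem toUnitary_mul (g h : Matrix.specialUnitaryGroup n ℂ) : toUnitary (g * h) = toUnitary g * toUnitary h :=
  Subtype.ext rfl

/-- `toUnitary` commutes with inversion. [folklore] -/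
theorem toUnitary_inv (g : Matrix.specialUnitaryGroup n ℂ) : toUnitary g⁻¹ = (toUnitary g)⁻¹ :=
  Subtype.ext rfl

/-- The adjoint action of `SU(n)` on 𝔰𝔲(n) as a real-linear automorphism. [folklore] -/
def sadEquiv (g : Matrix.specialUnitaryGroup n ℂ) : lieSU n ≃ₗ[ℝ] lieSU n :=
  { (conjL (g : Matrix n n ℂ)).restrict fun _ hX => conj_mem_lieSU hX (toUnitary g) with
    invFun := (conjL ((g⁻¹ : Matrix.specialUnitaryGroup n ℂ) : Matrix n n ℂ)).restrict
      fun _ hX => conj_mem_lieSU hX (toUnitary g⁻¹)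
    left_inv := fun X =>
      Subtype.ext <| conj_conj_of_mul_eq_one (star_coe_mul_coe (toUnitary g)) (X : Matrix n n ℂ)
    right_inv := fun X =>
      Subtype.ext <| conj_conj_of_mul_eq_one (coe_mul_star_coe (toUnitary g)) (X : Matrix n n ℂ) }

/-- `sadEquiv g X = g X g*` on underlying matrices. [folklore] -/
@[simp] theorem coe_sadEquiv (g : Matrix.specialUnitaryGroup n ℂ) (X : lieSU n) :
    ((sadEquiv g X : lieSU n) : Matrix n n ℂ) = (g : Matrix n n ℂ) * X * star (g : Matrix n n ℂ) := rfl

/-- THE ADJOINT REPRESENTATION OF SU(n) on 𝔰𝔲(n) by linear isometries (Hilbert–Schmidt inner product).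
[cite: Balaban1988Convergent, (1.17) p.250] -/
def specialUnitaryAd (g : Matrix.specialUnitaryGroup n ℂ) : lieSU n ≃ₗᵢ[ℝ] lieSU n :=
  (sadEquiv g).isometryOfInner fun X Y => by
    rw [Submodule.coe_inner, Submodule.coe_inner, coe_sadEquiv, coe_sadEquiv]
    exact inner_conj_unitary (toUnitary g) X Y

/-- `specialUnitaryAd g X = g X g*` on underlying matrices. [folklore] -/
@[simp] theorem coe_specialUnitaryAd (g : Matrix.specialUnitaryGroup n ℂ) (X : lieSU n) :
    ((specialUnitaryAd g X : lieSU n) : Matrix n n ℂ) = (g : Matrix n n ℂ) * X * star (g : Matrix n n ℂ) := rfl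

/-- `hmul` for SU(n). [cite: Balaban1985Averaging, (57) p.27] -/
theorem specialUnitaryAd_mul (g h : Matrix.specialUnitaryGroup n ℂ) (X : lieSU n) :
    specialUnitaryAd (g * h) X = specialUnitaryAd g (specialUnitaryAd h X) := by
  apply Subtype.ext
  simp only [coe_specialUnitaryAd]
  exact conj_mul_conj _ _ _

/-- `hinv` for SU(n). [cite: Balaban1985Averaging, (57) p.27] -/
theorem specialUnitaryAd_inv_apply (g : Matrix.specialUnitaryGroup n ℂ) (X : lieSU n) :
    specialUnitaryAd g⁻¹ (specialUnitaryAd g X) = X :=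
  Subtype.ext <| conj_conj_of_mul_eq_one (star_coe_mul_coe (toUnitary g)) (X : Matrix n n ℂ)

/-- `exp X ∈ SU(n)` for `X ∈ 𝔰𝔲(n)`: unitary by §2 and `det exp X = exp Tr X = 1` (tree
`Literature.Analysis.Matrix.det_exp_eq_exp_trace`). [folklore] -/
theorem exp_mem_specialUnitaryGroup_of_mem_lieSU {X : Matrix n n ℂ} (hX : X ∈ lieSU n) :
    NormedSpace.exp X ∈ Matrix.specialUnitaryGroup n ℂ := by
  rw [Matrix.mem_specialUnitaryGroup_iff]
  refine ⟨exp_mem_unitaryGroup_of_mem_lieU (mem_lieU_iff.mpr (mem_lieSU_iff.mp hX).1), ?_⟩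
  rw [Literature.Analysis.Matrix.det_exp_eq_exp_trace, (mem_lieSU_iff.mp hX).2, NormedSpace.exp_zero]

/-- THE EXPONENTIAL MAP `𝔰𝔲(n) → SU(n)`. [cite: Balaban1988Convergent, (1.19) p.250] -/
def expSU (X : lieSU n) : Matrix.specialUnitaryGroup n ℂ :=
  ⟨NormedSpace.exp (X : Matrix n n ℂ), exp_mem_specialUnitaryGroup_of_mem_lieSU X.2⟩

/-- `expSU X = exp X` on underlying matrices. [folklore] -/
@[simp] theorem coe_expSU (X : lieSU n) :
    ((expSU X : Matrix.specialUnitaryGroup n ℂ) : Matrix n n ℂ) = NormedSpace.exp (X : Matrix n n ℂ) := rfl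

/-- `hexp` for SU(n): `expSU (Ad(g)X) = g · expSU X · g⁻¹`. [cite: Balaban1985BackgroundPropagators, (3.29) p.395] -/
theorem expSU_specialUnitaryAd (g : Matrix.specialUnitaryGroup n ℂ) (X : lieSU n) :
    expSU (specialUnitaryAd g X) = g * expSU X * g⁻¹ := by
  apply Subtype.ext
  change NormedSpace.exp ((g : Matrix n n ℂ) * X * star (g : Matrix n n ℂ))
    = (g : Matrix n n ℂ) * NormedSpace.exp (X : Matrix n n ℂ) * star (g : Matrix n n ℂ)
  exact exp_conj_unitary (toUnitary g) X

/-- `hn` for SU(n), Hilbert–Schmidt norm. [cite: Balaban1985Averaging, (17) p.21] -/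
theorem norm_specialUnitaryAd (g : Matrix.specialUnitaryGroup n ℂ) (X : lieSU n) : ‖specialUnitaryAd g X‖ = ‖X‖ :=
  (specialUnitaryAd g).norm_map X

/-- The operator norm (19) on 𝔰𝔲(n). [cite: Balaban1985Averaging, (19) p.21] -/
def opNormSU (X : lieSU n) : ℝ := opNormU (⟨(X : Matrix n n ℂ), (Submodule.mem_inf.mp X.2).1⟩ : lieU n)

/-- `hn` for SU(n), operator norm. [cite: Balaban1985Averaging, (19) p.21] -/
theorem opNormSU_specialUnitaryAd (g : Matrix.specialUnitaryGroup n ℂ) (X : lieSU n) :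
    opNormSU (specialUnitaryAd g X) = opNormSU X := by
  unfold opNormSU opNormU
  exact opNorm_conj_unitary (toUnitary g) X

section Consequences

variable [Nonempty n] {P : Params} {j : ℕ}

/-- (3.3) is a covariant family in the SU(n) model (`hmul`, `hinv` discharged). [cite: Balaban1985BackgroundPropagators, (3.3) p.391] -/
theorem opCovariant_covDeriv_specialUnitary :
    OpCovariant (jrot (P := P) (j := j) (G := Matrix.specialUnitaryGroup n ℂ)) (adAct specialUnitaryAd (ι := Site P j))
      (adAct specialUnitaryAd (ι := PBond P j)) (covDeriv specialUnitaryAd) := by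
  exact opCovariant_covDeriv specialUnitaryAd_mul specialUnitaryAd_inv_apply

/-- The mixed cut-off (1.19) is jointly invariant in the SU(n) model (`hexp` discharged). [cite: Balaban1988Convergent, (1.19) p.250] -/
theorem mixedSmallOn_joint_iff_specialUnitary (S : Set (PBond P j)) (δ : ℝ) (g : Matrix.specialUnitaryGroup n ℂ)
    (W U : GaugeField P j (Matrix.specialUnitaryGroup n ℂ)) (A : VecField P j (lieSU n)) :
    MixedSmallOn S δ expSU (conjFun g W) (conjFun g U) (adAct specialUnitaryAd g A) ↔ MixedSmallOn S δ expSU W U A := by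
  exact mixedSmallOn_joint_iff expSU_specialUnitaryAd S δ g W U A

/-- The (1.19)-type characteristic function is a jointly invariant weight in the SU(n) model (fixed reference field).
[folklore] -/
theorem invariant_charFn_mixedSmallOn_specialUnitary (S : Set (PBond P j)) (δ : ℝ)
    {W : GaugeField P j (Matrix.specialUnitaryGroup n ℂ)} (hW : ∀ g : Matrix.specialUnitaryGroup n ℂ, conjFun g W = W) :
    Invariant (prodAct (jrot (P := P) (j := j) (G := Matrix.specialUnitaryGroup n ℂ)) (adAct specialUnitaryAd (ι := PBond P j)))
      (charFn fun p : GaugeField P j (Matrix.specialUnitaryGroup n ℂ) × VecField P j (lieSU n) =>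
        MixedSmallOn S δ expSU W p.1 p.2) := by
  exact invariant_charFn_mixedSmallOn expSU_specialUnitaryAd S δ hW

/-- The sup cut-off (1.18) is a jointly invariant weight in the SU(n) model, for either norm (`hn` discharged).
[cite: Balaban1988Convergent, (1.18) p.250] -/
theorem invariant_charFn_supSmallOn_specialUnitary (S : Set (PBond P j)) (δ : ℝ) :
    Invariant (prodAct (jrot (P := P) (j := j) (G := Matrix.specialUnitaryGroup n ℂ)) (adAct specialUnitaryAd (ι := PBond P j)))
        (charFn fun p : GaugeField P j (Matrix.specialUnitaryGroup n ℂ) × VecField P j (lieSU n) =>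
          SupSmallOn S (fun X : lieSU n => ‖X‖) δ p.2) ∧
      Invariant (prodAct (jrot (P := P) (j := j) (G := Matrix.specialUnitaryGroup n ℂ)) (adAct specialUnitaryAd (ι := PBond P j)))
        (charFn fun p : GaugeField P j (Matrix.specialUnitaryGroup n ℂ) × VecField P j (lieSU n) =>
          SupSmallOn S opNormSU δ p.2) := by
  exact ⟨invariant_charFn_supSmallOn norm_specialUnitaryAd S δ,
    invariant_charFn_supSmallOn opNormSU_specialUnitaryAd S δ⟩

end Consequences

end SpecialUnitary

/-! ## §6 Non-vacuity: the Lie algebras of the model are non-zero -/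

section NonVacuity

/-- `i·1 ∈ 𝔲(n)`. [folklore] -/
theorem I_smul_one_mem_lieU : (Complex.I • (1 : Matrix n n ℂ)) ∈ lieU n := by
  rw [mem_lieU_iff, star_smul, star_one, Complex.star_def, Complex.conj_I, neg_smul]

/-- 𝔲(n) ≠ 0 for non-empty `n` (the A-field fibres `PBond P j → 𝔲(n)` of the model are not trivial, so the
invariance statements of §4 are not vacuous). [folklore] -/
theorem exists_ne_zero_lieU [Nonempty n] : ∃ X : lieU n, X ≠ 0 := by
  obtain ⟨i⟩ := ‹Nonempty n›
  refine ⟨⟨Complex.I • (1 : Matrix n n ℂ), I_smul_one_mem_lieU⟩, fun h => Complex.I_ne_zero ?_⟩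
  have hM : Complex.I • (1 : Matrix n n ℂ) = 0 := congrArg Subtype.val h
  have hii := congrFun (congrFun hM i) i
  rwa [Matrix.smul_apply, Matrix.one_apply_eq, smul_eq_mul, mul_one, Matrix.zero_apply] at hii

/-- `E_ij − E_ji ∈ 𝔰𝔲(n)` for `i ≠ j`. [folklore] -/
theorem single_sub_single_mem_lieSU {i j : n} (hij : i ≠ j) :
    (Matrix.single i j (1 : ℂ) - Matrix.single j i 1) ∈ lieSU n := by
  rw [mem_lieSU_iff]
  refine ⟨?_, ?_⟩
  · rw [star_sub, star_eq_conjTranspose, star_eq_conjTranspose, conjTranspose_single, conjTranspose_single,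
      star_one, neg_sub]
  · rw [trace_sub, trace_single_eq_of_ne i j (1 : ℂ) hij, trace_single_eq_of_ne j i (1 : ℂ) (Ne.symm hij), sub_zero]

/-- 𝔰𝔲(n) ≠ 0 as soon as `n` has two distinct elements. [folklore] -/
theorem exists_ne_zero_lieSU {i j : n} (hij : i ≠ j) : ∃ X : lieSU n, X ≠ 0 := by
  refine ⟨⟨_, single_sub_single_mem_lieSU hij⟩, fun h => one_ne_zero (α := ℂ) ?_⟩
  have hM : Matrix.single i j (1 : ℂ) - Matrix.single j i 1 = 0 := congrArg Subtype.val h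
  have hij' := congrFun (congrFun hM i) j
  rwa [Matrix.sub_apply, Matrix.single_apply_same, Matrix.single_apply_of_row_ne (Ne.symm hij), sub_zero,
    Matrix.zero_apply] at hij'

end NonVacuity

end Frobenius

end Literature.MathematicalPhysics.QuantumFieldTheory.Balaban1983to89.T4AdjointCovarianceUnitary
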